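import Summits.AnomalousDissipation.AnomalousDissipation.Theorems.SolenoidalFractalHomogenisationRealisedQuasiStaticCellLawSlotTimes
import Summits.AnomalousDissipation.AnomalousDissipation.Theorems.SolenoidalFractalHomogenisationPermissibleFractalCarrierTime
import Literature.Analysis.FluidPDE.QuasiStaticSlotWeight
import HarnessLib

/-!
# Negative side of K2Q `QuasiStaticSolenoidalCellTensorQ` (stmt-AnomalousDissipation-19072): the time integral of the squared
# slot envelope over whole periods (helper, `--supports stmt-AnomalousDissipation-19072`)

Summits-side helper file (everything proved; no definitions, no named facts).  The Taylor drain density of the window floor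
lemma is `Σ_j trap_j(t)² · G_j` with `trap_j(t) = trapezoid (start j) τ_j ρ (fract(t/P)·P)` the replayed envelope of slot `j`;
its primitive is what the window lemma's `Φ` is made of.  This file supplies the calculus:
* `continuous_trapSq`, `hasDerivWithinAt_integral_trapSq` — the replayed squared envelope is continuous, so
  `t ↦ ∫_{t₀}^t trap_j²` has derivative `trap_j(t)²` within any window (FTC-1);
* `integral_trapSq_nonneg`, `integral_trapSq_mono` — the primitive is non-negative and non-decreasing;
* `integral_trapSq_period` — over ONE whole period `[mP, (m+1)P]` it equals `τ_j(1 − 4ρ/3)` (the envelope factor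
  `⨍a² = 1 − 4ρ/3` of the `slotGain` docstring, `integral_trapezoid_sq`), and
* `integral_trapSq_periods` — over `q` whole periods it equals `q·τ_j(1 − 4ρ/3)`.
This is NOT a proof of anomalous dissipation, and by itself not of `¬ K2Q`.
-/

set_option linter.dupNamespace false

noncomputable section

namespace Summit.AnomalousDissipation.AnomalousDissipation.Theorems.QuasiStaticSolenoidalCellTensorQ.Negative

open Set MeasureTheory Filter Topology Function intervalIntegral
open Literature.Analysis Literature.Analysis.FunctionSpaces Literature.Analysis.FunctionSpaces.Torus
open Literature.Analysis.FluidPDE Literature.Analysis.FluidPDE.LatticeShear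
open Summit.AnomalousDissipation.AnomalousDissipation.Theorems.SolenoidalFractalHomogenisation.PermissibleCarrier
open Summit.AnomalousDissipation.AnomalousDissipation.Theorems.SolenoidalFractalHomogenisation.RealisedQuasiStaticCellLaw

variable {k₀ : ℕ}

/-! ## §1 Continuity and the primitive -/

/-- The replayed squared envelope `t ↦ trap_j(fract(t/P)·P)²` is continuous. -/
theorem continuous_trapSq (W : LatticeWord k₀) (j : Fin k₀) :
    Continuous fun t : ℝ => LatticeWord.trapezoid (W.start j) (W.phase j).τ W.ramp
      (Int.fract (t / W.period) * W.period) ^ 2 := by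
  have h := continuous_trapezoid_fract W j 1
  simp only [one_mul] at h
  exact h.pow 2

/-- **FTC for the envelope primitive**: `t ↦ ∫_{t₀}^t trap_j²` has derivative `trap_j(t)²` within any set. -/
theorem hasDerivWithinAt_integral_trapSq (W : LatticeWord k₀) (j : Fin k₀) (t₀ : ℝ) (s : Set ℝ) (t : ℝ) :
    HasDerivWithinAt (fun u => ∫ x in t₀..u, LatticeWord.trapezoid (W.start j) (W.phase j).τ W.ramp
        (Int.fract (x / W.period) * W.period) ^ 2)
      (LatticeWord.trapezoid (W.start j) (W.phase j).τ W.ramp (Int.fract (t / W.period) * W.period) ^ 2) s t :=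
  ((continuous_trapSq W j).integral_hasStrictDerivAt t₀ t).hasDerivAt.hasDerivWithinAt

/-- The envelope primitive is non-negative for `t₀ ≤ t`. -/
theorem integral_trapSq_nonneg (W : LatticeWord k₀) (j : Fin k₀) {t₀ t : ℝ} (h : t₀ ≤ t) :
    0 ≤ ∫ x in t₀..t, LatticeWord.trapezoid (W.start j) (W.phase j).τ W.ramp (Int.fract (x / W.period) * W.period) ^ 2 :=
  intervalIntegral.integral_nonneg h fun _ _ => sq_nonneg _

/-- The envelope primitive is non-decreasing in its upper limit. -/
theorem integral_trapSq_mono (W : LatticeWord k₀) (j : Fin k₀) (t₀ : ℝ) {t t' : ℝ} (h : t ≤ t') :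
    ∫ x in t₀..t, LatticeWord.trapezoid (W.start j) (W.phase j).τ W.ramp (Int.fract (x / W.period) * W.period) ^ 2 ≤
      ∫ x in t₀..t', LatticeWord.trapezoid (W.start j) (W.phase j).τ W.ramp (Int.fract (x / W.period) * W.period) ^ 2 := by
  have hi : ∀ a b : ℝ, IntervalIntegrable (fun x => LatticeWord.trapezoid (W.start j) (W.phase j).τ W.ramp
      (Int.fract (x / W.period) * W.period) ^ 2) volume a b := fun a b => (continuous_trapSq W j).intervalIntegrable a b
  rw [← integral_add_adjacent_intervals (hi t₀ t) (hi t t')]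
  have := integral_trapSq_nonneg W j h
  linarith

/-! ## §2 One whole period -/

/-- Over `[0, P]` the squared envelope of slot `j` integrates to `τ_j(1 − 4ρ/3)`. -/
theorem integral_trapSq_zero_period (W : LatticeWord k₀) (j : Fin k₀) :
    ∫ x in (0:ℝ)..W.period, LatticeWord.trapezoid (W.start j) (W.phase j).τ W.ramp x ^ 2 =
      (W.phase j).τ * (1 - 4 * W.ramp / 3) := by
  have hτ := (W.phase j).τ_pos
  have hρ := W.ramp_pos
  have hρ2 := W.ramp_le
  have hs0 := start_nonneg W j
  have hsP := start_add_tau_le_period W j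
  set a := W.start j with ha
  set τ := (W.phase j).τ with hτdef
  have hc : Continuous fun x : ℝ => LatticeWord.trapezoid 0 τ W.ramp x ^ 2 := by
    have : Continuous fun x : ℝ => LatticeWord.trapezoid 0 τ W.ramp x := by unfold LatticeWord.trapezoid; fun_prop
    exact this.pow 2
  have hi : ∀ u v : ℝ, IntervalIntegrable (fun x => LatticeWord.trapezoid 0 τ W.ramp x ^ 2) volume u v :=
    fun u v => hc.intervalIntegrable u v
  -- shift to the slot's own clock
  have e1 : ∫ x in (0:ℝ)..W.period, LatticeWord.trapezoid a τ W.ramp x ^ 2 =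
      ∫ x in (0:ℝ) - a..W.period - a, LatticeWord.trapezoid 0 τ W.ramp x ^ 2 := by
    rw [← intervalIntegral.integral_comp_sub_right (fun x => LatticeWord.trapezoid 0 τ W.ramp x ^ 2) a]
    refine intervalIntegral.integral_congr fun x _ => ?_
    simp only [trapezoid_shift a τ W.ramp x]
  rw [e1]
  -- split `[-a, P - a] = [-a, 0] ∪ [0, τ] ∪ [τ, P - a]`; the outer pieces vanish
  have h0a : (0:ℝ) - a ≤ 0 := by linarith
  have hτP : τ ≤ W.period - a := by linarith
  rw [← integral_add_adjacent_intervals (hi (0 - a) 0) (hi 0 (W.period - a)),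
    ← integral_add_adjacent_intervals (hi 0 τ) (hi τ (W.period - a))]
  have z1 : ∫ x in (0:ℝ) - a..0, LatticeWord.trapezoid 0 τ W.ramp x ^ 2 = 0 := by
    rw [intervalIntegral.integral_congr (g := fun _ => (0:ℝ)) (fun x hx => by
      rw [uIcc_of_le h0a] at hx
      simp only [trapezoid_eq_zero_of_nonpos hτ hρ hx.2]
      simp), intervalIntegral.integral_zero]
  have z2 : ∫ x in τ..W.period - a, LatticeWord.trapezoid 0 τ W.ramp x ^ 2 = 0 := by
    rw [intervalIntegral.integral_congr (g := fun _ => (0:ℝ)) (fun x hx => by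
      rw [uIcc_of_le hτP] at hx
      simp only [trapezoid_eq_zero_of_tau_le hτ hρ hx.1]
      simp), intervalIntegral.integral_zero]
  rw [z1, z2, integral_trapezoid_sq hτ hρ hρ2]
  ring

/-- **Over one whole period** `[mP, (m+1)P]` the replayed squared envelope of slot `j` integrates to `τ_j(1 − 4ρ/3)`. -/
theorem integral_trapSq_period (W : LatticeWord k₀) (j : Fin k₀) (m : ℕ) :
    ∫ x in ((m : ℝ) * W.period)..(((m : ℝ) + 1) * W.period),
        LatticeWord.trapezoid (W.start j) (W.phase j).τ W.ramp (Int.fract (x / W.period) * W.period) ^ 2 =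
      (W.phase j).τ * (1 - 4 * W.ramp / 3) := by
  have hP := period_pos W
  have hρτ : 0 < W.ramp * (W.phase j).τ := mul_pos W.ramp_pos (W.phase j).τ_pos
  -- on the closed period the replayed envelope is the shifted one
  have hcongr : EqOn (fun x => LatticeWord.trapezoid (W.start j) (W.phase j).τ W.ramp (Int.fract (x / W.period) * W.period) ^ 2)
      (fun x => LatticeWord.trapezoid (W.start j) (W.phase j).τ W.ramp (x - (m : ℝ) * W.period) ^ 2)
      (uIcc ((m : ℝ) * W.period) (((m : ℝ) + 1) * W.period)) := by
    intro x hx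
    rw [uIcc_of_le (by nlinarith)] at hx
    simp only
    rcases lt_or_eq_of_le hx.2 with hlt | heq
    · have e : x = ((m : ℤ) : ℝ) * W.period + (x - (m : ℝ) * W.period) := by push_cast; ring
      have h1 : 0 ≤ x - (m : ℝ) * W.period := by linarith [hx.1]
      have h2 : x - (m : ℝ) * W.period < W.period := by linarith
      have := fract_period_mul hP (m : ℤ) h1 h2
      rw [← e] at this
      rw [this]
    · rw [heq]
      have e : ((m : ℝ) + 1) * W.period / W.period = ((m + 1 : ℕ) : ℤ) := by push_cast; field_simp
      rw [e, Int.fract_intCast, zero_mul, show ((m : ℝ) + 1) * W.period - (m : ℝ) * W.period = W.period by ring,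
        trapezoid_start_period W j]
      rw [trapezoid_eq_zero_of_le hρτ (start_nonneg W j)]
  rw [intervalIntegral.integral_congr hcongr,
    intervalIntegral.integral_comp_sub_right (fun x => LatticeWord.trapezoid (W.start j) (W.phase j).τ W.ramp x ^ 2)
      ((m : ℝ) * W.period)]
  rw [show (m : ℝ) * W.period - (m : ℝ) * W.period = 0 by ring,
    show ((m : ℝ) + 1) * W.period - (m : ℝ) * W.period = W.period by ring]
  exact integral_trapSq_zero_period W j

/-! ## §3 Several whole periods -/

/-- **Over `q` whole periods** `[pP, (p+q)P]` the replayed squared envelope of slot `j` integrates to `q·τ_j(1 − 4ρ/3)`. -/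
theorem integral_trapSq_periods (W : LatticeWord k₀) (j : Fin k₀) (p q : ℕ) :
    ∫ x in ((p : ℝ) * W.period)..(((p : ℝ) + q) * W.period),
        LatticeWord.trapezoid (W.start j) (W.phase j).τ W.ramp (Int.fract (x / W.period) * W.period) ^ 2 =
      (q : ℝ) * ((W.phase j).τ * (1 - 4 * W.ramp / 3)) := by
  induction q with
  | zero => simp
  | succ q ih =>
    have hi : ∀ a b : ℝ, IntervalIntegrable (fun x => LatticeWord.trapezoid (W.start j) (W.phase j).τ W.ramp
        (Int.fract (x / W.period) * W.period) ^ 2) volume a b := fun a b => (continuous_trapSq W j).intervalIntegrable a b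
    rw [← integral_add_adjacent_intervals (hi _ (((p : ℝ) + q) * W.period)) (hi _ _), ih]
    have h := integral_trapSq_period W j (p + q)
    push_cast at h ⊢
    rw [show ((p : ℝ) + (q + 1)) * W.period = ((p : ℝ) + q + 1) * W.period by ring, h]
    ring

end Summit.AnomalousDissipation.AnomalousDissipation.Theorems.QuasiStaticSolenoidalCellTensorQ.Negative

end
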